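import Mathlib
import Summits.NavierStokesRegularity.NavierStokesRegularity.Theorems.EulerZoomLiouvillePowerGaugeEulerLiouvilleFadingSteepVorticityPast
import HarnessLib.Audit

/-!
# Crux E `PowerGaugeEulerLiouville` (stmt-NavierStokesRegularity-19832): STEEP-VORTICITY LOG-TIME BREATHERS are trivial
# (line `logtime-breathers`, a bite out of the residue T3 `stub_wildBreatherRest`)

Route `EulerZoomLiouville` (NavierStokesRegularity), crux E.  The LOG-TIME BREATHERS of line `logtime-breathers` (crux dir
`Cruxes/PowerGaugeEulerLiouville/Lines/logtime-breathers.md`, ns-idea-11): `u(τ, y) = e^{cτ} V(e^{−cτ} y)` for `τ < 0`.  T2b (LEAD ns-typeII-p2 g10,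
`…LogtimeBreatherTame`) kills the TAME profiles `‖∇V(z)‖ ≤ C(1+‖z‖)^{−(1+ε)}`.  This file kills a slice of the WILD residue T3: profiles that
are BOUNDED, `‖V(z)‖ ≤ B`, with a merely BOUNDED gradient `‖∇V(z)‖ ≤ C` but STEEPLY DECAYING VORTICITY `‖curl V(z)‖ ≤ D(1+‖z‖)^{−k}`,
`k c > C` (`c > 0`).  Such a classical breather member has a fading past with bounded gradient and steep vorticity in the sense of
`…FadingSteepVorticityPast`: `‖u(τ,y)‖ ≤ B e^{cτ}`, `∇u(τ, y) = ∇V(e^{−cτ}y)` (so `‖∇u‖ ≤ C` and `curl u(τ, y) = curl V(e^{−cτ}y)`,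
`‖curl u(τ,y)‖ ≤ D(1 + e^{−cτ}‖y‖)^{−k}`), hence `FadingSteepPast.ae_eq_zero_of_gauge_of_fadingSteepVorticityPast` applies with `T₁ = 0`.
The boundedness of `V` is a genuine hypothesis here (a bounded gradient alone does not make the velocity fade: `V(z) = Az`, `A` symmetric
trace-free, is a steady linear — irrotational — flow).
WHAT THIS IS NOT: not NS regularity, not the crux E — one more classical stratum (hypothetical Euler zoom-limit class) for the lead skeleton;
the rest of T3 (unbounded or slowly-decaying-vorticity wild profiles) stays OPEN.  [folklore; line card `Lines/logtime-breathers.md` T3]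
-/

noncomputable section

set_option linter.dupNamespace false

open MeasureTheory Set Filter Topology Metric Function
open scoped NNReal ENNReal ContDiff

namespace Summit.NavierStokesRegularity.NavierStokesRegularity.Theorems.PowerGaugeEulerLiouville.LogtimeBreather

open Literature.Analysis Literature.Analysis.FluidPDE

variable {u : ℝ → EuclideanSpace ℝ (Fin 3) → EuclideanSpace ℝ (Fin 3)} {p : ℝ → EuclideanSpace ℝ (Fin 3) → ℝ}

/-- **STEEP-VORTICITY LOG-TIME BREATHERS ARE TRIVIAL** (line `logtime-breathers`, inside residue T3; binders = the line's `IsLogtimeBreather u c V`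
unfolded, plus the steep-profile hypotheses).  Crux hypotheses verbatim (`0 < ρ ≤ ½`) + `(u, p)` classical on the past +
`u(τ, y) = e^{cτ} V(e^{−cτ} y)` for all `τ < 0` with `c > 0` + `‖V(z)‖ ≤ B` + `‖∇V(z)‖ ≤ C` + `‖curl V(z)‖ ≤ D(1 + ‖z‖)^{−k}` with `k c > C`
⇒ `u = 0` a.e. on `(−∞, 0) × ℝ³` (`FadingSteepPast.ae_eq_zero_of_gauge_of_fadingSteepVorticityPast` with `T₁ = 0`).
[folklore; line card `Lines/logtime-breathers.md` T3] -/
theorem ae_eq_zero_of_gauge_of_steepVorticityBreather {ρ : ℝ} (hρ : 0 < ρ) (hρh : ρ ≤ 1 / 2)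
    {H : ℝ → EuclideanSpace ℝ (Fin 3) → EuclideanSpace ℝ (Fin 3) →L[ℝ] EuclideanSpace ℝ (Fin 3)} {c₀ : ℝ≥0}
    (hsw : IsSuitableWeakSolutionOn (slab (EuclideanSpace ℝ (Fin 3)) (Iio 0) isOpen_Iio) 0 0 u p)
    (hH : HasWeakSpatialGradientOn (slab (EuclideanSpace ℝ (Fin 3)) (Iio 0) isOpen_Iio) u H)
    (hgauge : ∀ a : ℝ, 0 < a →
      ENNReal.ofReal (a ^ (2 * ρ)) * cknA a (0 : ℝ × EuclideanSpace ℝ (Fin 3)) u +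
          ENNReal.ofReal (a ^ ρ) * cknE a (0 : ℝ × EuclideanSpace ℝ (Fin 3)) H +
        ENNReal.ofReal (a ^ (2 * ρ)) * cknD a (0 : ℝ × EuclideanSpace ℝ (Fin 3)) p ≤ (c₀ : ℝ≥0∞))
    (hcl : IsClassicalEulerSolutionOn (Iio 0) 0 u p) {c : ℝ} {V : EuclideanSpace ℝ (Fin 3) → EuclideanSpace ℝ (Fin 3)}
    (hc : 0 < c) (hbr : c ≠ 0 ∧ ∀ τ : ℝ, τ < 0 → ∀ y, u τ y = Real.exp (c * τ) • V (Real.exp (-(c * τ)) • y))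
    {B C D k : ℝ} (hVb : ∀ z, ‖V z‖ ≤ B) (hVgrad : ∀ z, ‖fderiv ℝ V z‖ ≤ C)
    (hVcurl : ∀ z, ‖curl V z‖ ≤ D * (1 + ‖z‖) ^ (-k)) (hkc : C < k * c) :
    uncurry u =ᵐ[volume.restrict (Iio (0 : ℝ) ×ˢ (univ : Set (EuclideanSpace ℝ (Fin 3))))] 0 := by
  -- adapted from …LogtimeBreatherTame (`LogtimeBreather.ae_eq_zero_of_gauge_of_tameBreather`)
  obtain ⟨-, hbr⟩ := hbr
  -- the profile is `C¹`: `V z = e^{c} u(−1, e^{−c} z)`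
  have hVrep : V = fun z => Real.exp c • u (-1) (Real.exp (-c) • z) := by
    funext z
    have h := hbr (-1) (by norm_num) (Real.exp (-c) • z)
    rw [mul_neg_one, neg_neg, smul_smul, ← Real.exp_add, add_neg_cancel, Real.exp_zero, one_smul] at h
    rw [h, smul_smul, ← Real.exp_add, add_neg_cancel, Real.exp_zero, one_smul]
  have hV : ContDiff ℝ 1 V := by
    rw [hVrep]
    have h1 : ContDiff ℝ 1 (u (-1)) := (hcl.contDiff_velocity (by norm_num : (-1 : ℝ) < 0)).of_le (by exact_mod_cast le_top)
    exact (h1.comp (contDiff_const_smul _)).const_smul _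
  have hVd : Differentiable ℝ V := hV.differentiable one_ne_zero
  -- (H1) exponentially fading velocity
  have hvel : ∀ s : ℝ, s < 0 → ∀ y, ‖u s y‖ ≤ B * Real.exp (c * s) := by
    intro s hs y
    rw [hbr s hs y, norm_smul, Real.norm_eq_abs, abs_of_pos (Real.exp_pos _), mul_comm]
    exact mul_le_mul_of_nonneg_right (hVb _) (Real.exp_pos _).le
  -- the gradient in the breathing variable: `∇u(s, y) = ∇V(e^{-cs} y)`
  have hder : ∀ s : ℝ, s < 0 → ∀ y, fderiv ℝ (u s) y = fderiv ℝ V (Real.exp (-(c * s)) • y) := by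
    intro s hs y
    have hus : u s = fun y => Real.exp (c * s) • V (Real.exp (-(c * s)) • y) := funext (hbr s hs)
    have h : HasFDerivAt (u s) (fderiv ℝ V (Real.exp (-(c * s)) • y)) y := by
      rw [hus]
      have h1 : HasFDerivAt (fun y : EuclideanSpace ℝ (Fin 3) => Real.exp (-(c * s)) • y)
          (Real.exp (-(c * s)) • ContinuousLinearMap.id ℝ (EuclideanSpace ℝ (Fin 3))) y :=
        (ContinuousLinearMap.id ℝ (EuclideanSpace ℝ (Fin 3))).hasFDerivAt.const_smul (Real.exp (-(c * s)))
      have h2 := ((hVd (Real.exp (-(c * s)) • y)).hasFDerivAt.comp y h1).const_smul (Real.exp (c * s))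
      refine h2.congr_fderiv ?_
      ext v
      simp only [FunLike.coe_smul, Pi.smul_apply, ContinuousLinearMap.comp_apply, ContinuousLinearMap.id_apply,
        map_smul, smul_smul, ← Real.exp_add, add_neg_cancel, Real.exp_zero, one_smul]
    exact h.fderiv
  -- (H2) bounded gradient
  have hgrad : ∀ s : ℝ, s < 0 → ∀ y, ‖fderiv ℝ (u s) y‖ ≤ C := by
    intro s hs y
    rw [hder s hs y]
    exact hVgrad _
  -- (H3) steep vorticity: `curl u(s, y) = curl V(e^{-cs} y)`
  have hcurl : ∀ s : ℝ, s < 0 → ∀ y, ‖curl (u s) y‖ ≤ D * (1 + Real.exp (-(c * s)) * ‖y‖) ^ (-k) := by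
    intro s hs y
    have hcv : curl (u s) y = curl V (Real.exp (-(c * s)) • y) := by
      unfold curl
      rw [hder s hs y]
    rw [hcv]
    have h := hVcurl (Real.exp (-(c * s)) • y)
    rwa [norm_smul, Real.norm_eq_abs, abs_of_pos (Real.exp_pos _)] at h
  exact FadingSteepPast.ae_eq_zero_of_gauge_of_fadingSteepVorticityPast hρ hρh hsw hH hgauge le_rfl hcl hc hvel hgrad hcurl hkc

end Summit.NavierStokesRegularity.NavierStokesRegularity.Theorems.PowerGaugeEulerLiouville.LogtimeBreather
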